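import Summits.KontsevichZagierPeriods.KontsevichZagierPeriods.Theses.TorsionLogs

/-!
# F3 WITNESS for the rung `NeronTorsionJets` (line `NeronTorsionVariation` on crux `TorsionSectorComplete`,
# stmt-KontsevichZagierPeriods-14212; forward generator G1 `next-rung`, gen 12, seed g1-KontsevichZagierPeriods-17981)

The rung is the jet-graded family `NeronTorsionJetMember : Bool → Prop` — member `false` := the floor decl
`Theses.TorsionLogs.NeronTorsionPrimitiveChain` VERBATIM (j = 0, the seed, CLOSED), member `true` := the tied
first-variation Néron–torsion sector statement `NeronTorsionVariationSector` (j = 1) — and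
`NeronTorsionJets := ∀ j, NeronTorsionJetMember j`.  The floor specialises the rung at the parameter `j := false`:
the seed theorem (route link `Theses.TorsionLogs.NeronTorsionPrimitiveChain_holds :=
Cruxes.NeronTorsionSector.Translation.stub_assembly`, item stmt-KontsevichZagierPeriods-17981) IS that member (`Iff.rfl`).
No `sorry`.  Self-contained: verbatim copies of the three `def`s of `Lines/NeronTorsionVariation.lean` in the namespace
`…NeronTorsionVariation.Special` (the skeleton module proves the same fact about the registered decl as `rung_false`).
[cite: KontsevichZagier2001, §1.2]
-/

noncomputable section

-- `Summit.KontsevichZagierPeriods.KontsevichZagierPeriods.…` is the tree's mandated layout (single-conjunct summit).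
set_option linter.dupNamespace false

namespace Summit.KontsevichZagierPeriods.KontsevichZagierPeriods.Cruxes.TorsionSectorComplete.NeronTorsionVariation.Special

open Literature.NumberTheory.Transcendental
open Summit.KontsevichZagierPeriods.KontsevichZagierPeriods.Theses.TorsionLogs (NeronTorsionPrimitiveChain
  NeronTorsionPrimitiveChain_holds)

/-- Verbatim copy of `Lines/NeronTorsionVariation.lean :: NeronTorsionVariationSector` (member `true`, j = 1). -/
def NeronTorsionVariationSector : Prop :=
  ∀ (g₂ g₃ e₁ xP yP ξ β : ℝ) (N a p q : ℕ) (f : ℝ → ℝ),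
    (∀ x, f x = 4 * x ^ 3 - g₂ * x - g₃) → g₂ ^ 3 - 27 * g₃ ^ 2 ≠ 0 → f e₁ = 0 → 0 < e₁ →
    (∀ x, e₁ < x → 0 < f x) → e₁ < xP → yP ^ 2 = f xP → 3 ≤ N → 0 < a → 2 * a < N →
    (∀ hns : (⟨0, 0, 0, -g₂ / 4, -g₃ / 4⟩ : WeierstrassCurve ℝ).toAffine.Nonsingular xP (yP / 2),
      addOrderOf (WeierstrassCurve.Affine.Point.some xP (yP / 2) hns) = N) →
    (N : ℝ) * (∫ x in Set.Ioi xP, (Real.sqrt (f x))⁻¹) = a * (2 * ∫ x in Set.Ioi e₁, (Real.sqrt (f x))⁻¹) →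
    Nat.Coprime p q → (q : ℤ) * ((N : ℤ) - 2 * (a : ℤ)) = (p : ℤ) * (2 * (N : ℤ)) →
    (N : ℝ) * (-(ξ / Real.sqrt (f xP)) + ∫ x in Set.Ioi xP, (x - e₁) / (2 * Real.sqrt (f x) ^ 3)) =
      a * (2 * ∫ x in Set.Ioi e₁, (x - e₁) / (2 * Real.sqrt (f x) ^ 3)) →
    ∀ (r₁ rb : KZ.IntegralRep 1) (rD rW : KZ.IntegralRep 2),
    r₁.domain = {t | e₁ < t 0 ∧ t 0 < xP} →
    Set.EqOn r₁.integrand (fun t => ξ / Real.sqrt (f xP) * (t 0 / Real.sqrt (f (t 0)))) r₁.domain →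
    rD.domain = {z | e₁ < z 1 ∧ z 1 < z 0 ∧ z 0 < xP} →
    Set.EqOn rD.integrand (fun z => z 1 * ((z 1 - e₁) / (2 * Real.sqrt (f (z 1)) ^ 3 * Real.sqrt (f (z 0)))
      + (z 0 - e₁) / (2 * Real.sqrt (f (z 1)) * Real.sqrt (f (z 0)) ^ 3))) rD.domain →
    rW.domain = {z | e₁ < z 0 ∧ e₁ < z 1} →
    Set.EqOn rW.integrand (fun z => (z 0 - e₁) / (2 * Real.sqrt (f (z 0)) ^ 3) *
        ((g₂ * z 1 + 2 * g₃) / (2 * (z 1) ^ 2 * Real.sqrt (f (z 1))))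
      + (Real.sqrt (f (z 0)))⁻¹ * ((z 1 - 2 * e₁) / (2 * (z 1) ^ 2 * Real.sqrt (f (z 1)))
        + (g₂ * z 1 + 2 * g₃) * (z 1 - e₁) / (4 * (z 1) ^ 2 * Real.sqrt (f (z 1)) ^ 3))) rW.domain →
    rb.domain = {t | 0 < t 0 ∧ t 0 < 1} → Set.EqOn rb.integrand (fun _ => β) rb.domain →
    (q : ℝ) ^ 2 * (r₁.value + rD.value) + (p : ℝ) ^ 2 * rW.value = rb.value →
    ((q : ℤ) ^ 2) • (KZ.of r₁ + KZ.of rD) + ((p : ℤ) ^ 2) • KZ.of rW - KZ.of rb ∈ KZ.relations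

/-- Verbatim copy of `Lines/NeronTorsionVariation.lean :: NeronTorsionJetMember` (the family, graded by jet order). -/
def NeronTorsionJetMember : Bool → Prop
  | false => NeronTorsionPrimitiveChain
  | true => NeronTorsionVariationSector

/-- Verbatim copy of `Lines/NeronTorsionVariation.lean :: NeronTorsionJets` (THE RUNG). -/
def NeronTorsionJets : Prop := ∀ one : Bool, NeronTorsionJetMember one

/-- Member `false` is the floor decl on the nose. -/
theorem false_iff : NeronTorsionJetMember false ↔ NeronTorsionPrimitiveChain :=
  Iff.rfl

/-- **F3 witness (named):** the floor (seed `stub_assembly`, route link `NeronTorsionPrimitiveChain_holds`) is the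
member `false` of the family. -/
theorem rung_false : NeronTorsionJetMember false :=
  NeronTorsionPrimitiveChain_holds

/-- The rung is exactly `floor ∧ member true` (honest containment: the rung adds ONE statement to the floor). -/
theorem rung_iff : NeronTorsionJets ↔ NeronTorsionPrimitiveChain ∧ NeronTorsionVariationSector := by
  constructor
  · exact fun h => ⟨h false, h true⟩
  · rintro ⟨h₀, h₁⟩ (_ | _)
    · exact h₀
    · exact h₁

/-- Given the floor (a theorem), the rung is equivalent to its new member. -/
theorem rung_iff_true : NeronTorsionJets ↔ NeronTorsionJetMember true :=
  ⟨fun h => h true, fun h => rung_iff.mpr ⟨NeronTorsionPrimitiveChain_holds, h⟩⟩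

end Summit.KontsevichZagierPeriods.KontsevichZagierPeriods.Cruxes.TorsionSectorComplete.NeronTorsionVariation.Special

end
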